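import Literature.NumberTheory.QuadraticFields.IdealClassLatticeSums
import HarnessLib

/-!
# Hallgren 2005 / class numbers under GRH — step N3a–b: counting the ideals of bounded norm of an
# imaginary quadratic field class by class, against lattice-point counts of the reduced forms

Topic `Literature/Computability/Cryptography`; proof companion of `HallgrenClassGroup.lean`
(named fact `Hallgren2005_classNumber_qsolvable_of_GRH`). Everything here is PROVED (theorems
only; no definition, no named fact).

The GRH-conditional analysis of the class-number algorithm needs `h(−d) ≫ √d / log d` (so that
random forms of discriminant `−d` spread over the class group). The tree proves the prime ideal
theorem under ERH uniformly in the field (`primeIdealCount_ge_of_erh`); to turn a lower bound for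
the number of (prime) ideals of norm `≤ N` into a lower bound for `h` one needs an UPPER bound for
the number of ideals of norm `≤ N` in each class. This file supplies it, as the unweighted twin of
the tree's harmonic `Quadratic.sum_card_absNorm_eq_div_le` (`IdealClassLatticeSums.lean`, whose
proof is followed line by line):

* `card_nonzero_ideals_le` — if `#T ≤ B(Q)` for every reduced form `Q` of discriminant `d_K` and
  every finite set `T` of non-zero lattice points `v` with `Q(v) ≤ N`, then
  `#{𝔞 ≠ 0 : N𝔞 ≤ N} ≤ ½ ∑_{Q ∈ reducedForms d_K} B(Q)` (class by class, the ideals of the class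
  `[𝔞_Q]⁻¹` of norm `≤ N` are `(λ)𝔞_Q⁻¹`, `λ ∈ 𝔞_Q ∖ 0` with `Q(u, −v) ≤ N`, and `±λ` give distinct
  points; Davenport, *Multiplicative Number Theory*, Ch. 6 (2)–(4));
* `card_latticePoints_le_of_mem_reducedForms` — for a reduced form `Q = (a, b, c)` of
  discriminant `D < 0` and such a `T`, `#T ≤ 16 N/√|D| + 8 √N + 1`
  (`4a Q(x, y) = (2ax + by)² + |D| y²`, so `|y| ≤ 2√(aN/|D|)` and `|x| ≤ |y|/2 + √(N/a)`, and
  `a ≤ √(|D|/3)`; Davenport Ch. 6, the lattice-point count behind `∑_{n ≤ N} r(n)`);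
* `card_nonzero_ideals_le_classNumber_mul` — hence
  `#{𝔞 ≠ 0 : N𝔞 ≤ N} ≤ ½ h_K (16 N/√|d_K| + 8 √N + 1)`.

## References

* H. Davenport, *Multiplicative Number Theory*, 2nd ed., GTM 74 (1980), Ch. 6 [DavenportMNT1980].
* D. A. Cox, *Primes of the form x² + ny²*, 2nd ed. (2013), §7.B Thm. 7.7 [Cox2013].
* A. M. Childs, W. van Dam, Rev. Mod. Phys. 82 (2010), §5.7 [ChildsVandam2010].
-/

noncomputable section

open scoped MatrixGroups nonZeroDivisors
open Module NumberField Finset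
open Literature.NumberTheory.EllipticCurves
open Literature.NumberTheory.QuadraticFields.Quadratic
open Literature.NumberTheory.QuadraticFields.BinaryQuadraticForm (reducedForms mem_reducedForms_iff
  discr_apply le_of_isReduced)

namespace Literature.Computability.Cryptography.Hallgren2005

variable {K : Type*} [Field K] [NumberField K]

/-! ### Ideals of bounded norm, class by class -/

/-- **`#{𝔞 ≠ 0 : N𝔞 ≤ N} ≤ ½ ∑_{Q reduced} B(Q)`.** Let `K` be an imaginary quadratic field,
`D = d_K`, and suppose `B(Q)` bounds the cardinality of every finite set `T` of non-zero lattice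
points `v` with `Q(v) ≤ N`, for every reduced form `Q` of discriminant `D`. Then the number of
non-zero integral ideals of norm `≤ N` is at most `½ ∑_{Q ∈ reducedForms D} B(Q)`. (Class by
class: the ideals in the class `[𝔞_Q]⁻¹` of norm `≤ N` are the `(λ)𝔞_Q⁻¹`,
`λ = uA + v(ω − k) ∈ 𝔞_Q ∖ 0`, with `N𝔞 · N𝔞_Q = A · Q(u, −v)` and `N𝔞_Q ≤ A`, so `Q(u, −v) ≤ N`;
`λ` and `−λ` give distinct points, whence twice the count is at most `B(Q)`; and every class is
`[𝔞_Q]⁻¹` with `Q` reduced, `reducedForms_mk0_bijective`.) The unweighted twin of the tree's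
`Quadratic.sum_card_absNorm_eq_div_le`; Davenport, Ch. 6 (2)–(4): `r(n) = w ∑_{classes} R(n, Q)`,
here one-sided and without the unit count. [cite: DavenportMNT1980, Ch. 6] -/
theorem card_nonzero_ideals_le (hK : IsImaginaryQuadratic K) (N : ℕ) (B : ℤ × ℤ × ℤ → ℝ)
    (hB : ∀ Q ∈ reducedForms (NumberField.discr K), ∀ T : Finset (ℤ × ℤ),
      (∀ v ∈ T, v ≠ 0 ∧ Q.1 * v.1 ^ 2 + Q.2.1 * v.1 * v.2 + Q.2.2 * v.2 ^ 2 ≤ N) →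
        (T.card : ℝ) ≤ B Q) :
    (Set.ncard {I : Ideal (𝓞 K) | I ≠ ⊥ ∧ Ideal.absNorm I ≤ N} : ℝ) ≤
      (1 / 2) * ∑ Q ∈ reducedForms (NumberField.discr K), B Q := by
  classical
  -- integral basis and discriminant
  obtain ⟨b, hb⟩ := exists_basis_zero_eq_one (K := K) hK.1
  set m : ℤ := b.repr (b 1 * b 1) 0 with hm
  set t : ℤ := b.repr (b 1 * b 1) 1 with ht
  have hω : b 1 * b 1 = (m : 𝓞 K) + (t : 𝓞 K) * b 1 := basis_one_mul_self_eq b hb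
  have hDK : NumberField.discr K = t ^ 2 + 4 * m := discr_eq_sq_add_four_mul b hb
  have hneg : t ^ 2 + 4 * m < 0 := hDK ▸ hK.discr_neg
  set D : ℤ := NumberField.discr K with hDdef
  have hD0 : D < 0 := hK.discr_neg
  /- 1. the finite set of non-zero ideals of norm `≤ N` -/
  set 𝓘 : Finset (Ideal (𝓞 K)) :=
    (Ideal.finite_setOf_absNorm_le (S := 𝓞 K) N).toFinset.filter (fun I => I ≠ ⊥) with h𝓘
  have hmem𝓘 : ∀ {I : Ideal (𝓞 K)}, I ∈ 𝓘 ↔ I ≠ ⊥ ∧ Ideal.absNorm I ≤ N := by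
    intro I
    rw [h𝓘, mem_filter, Set.Finite.mem_toFinset, Set.mem_setOf_eq, and_comm]
  have hset : {I : Ideal (𝓞 K) | I ≠ ⊥ ∧ Ideal.absNorm I ≤ N} = ↑𝓘 := by
    ext I
    rw [Set.mem_setOf_eq, mem_coe, hmem𝓘]
  rw [hset, Set.ncard_coe_finset]
  /- 2. decomposition by ideal classes -/
  let cls : Ideal (𝓞 K) → ClassGroup (𝓞 K) := fun I =>
    if h : I = ⊥ then 1 else ClassGroup.mk0 ⟨I, mem_nonZeroDivisors_of_ne_zero (by simpa using h)⟩
  let G : ClassGroup (𝓞 K) → ℝ := fun c => ((𝓘.filter (fun I => cls I = c)).card : ℝ)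
  have hG0 : ∀ c, 0 ≤ G c := fun c => Nat.cast_nonneg _
  have hdecomp : (𝓘.card : ℝ) = ∑ c : ClassGroup (𝓞 K), G c := by
    rw [card_eq_sum_card_fiberwise (f := cls) (t := (univ : Finset (ClassGroup (𝓞 K))))
      (fun I _ => mem_univ (cls I))]
    push_cast
    rfl
  rw [hdecomp]
  /- 3. the ideal of a reduced form and its class -/
  let 𝔟 : ℤ × ℤ × ℤ → Ideal (𝓞 K) := fun Q =>
    Ideal.span {(Q.1 : 𝓞 K), b 1 - (((Q.2.1 + t) / 2 : ℤ) : 𝓞 K)}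
  let cQ : ℤ × ℤ × ℤ → ClassGroup (𝓞 K) := fun Q =>
    if h : 0 < Q.1 then (ClassGroup.mk0 ⟨𝔟 Q, span_pair_mem_nonZeroDivisors b hb h.ne' _⟩)⁻¹ else 1
  have hsurj : ∀ c : ClassGroup (𝓞 K), ∃ Q ∈ reducedForms D, cQ Q = c := by
    intro c
    obtain ⟨⟨Q, hQ⟩, hc⟩ := (reducedForms_mk0_bijective b hb hω hneg).2 c⁻¹
    dsimp only at hc
    rw [← hDK] at hQ
    have hA : 0 < Q.1 := ((mem_reducedForms_iff hD0).1 hQ).2.1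
    refine ⟨Q, hQ, ?_⟩
    simp only [cQ, dif_pos hA]
    rw [inv_eq_iff_eq_inv, ← hc]
  have hstep : ∑ c : ClassGroup (𝓞 K), G c ≤ ∑ Q ∈ reducedForms D, G (cQ Q) := by
    rw [← sum_fiberwise_of_maps_to (s := reducedForms D) (t := (univ : Finset (ClassGroup (𝓞 K))))
      (g := cQ) (fun Q _ => mem_univ _)]
    refine sum_le_sum fun c _ => ?_
    obtain ⟨Q, hQ, hcQ⟩ := hsurj c
    have hmem : Q ∈ (reducedForms D).filter (fun Q => cQ Q = c) := mem_filter.2 ⟨hQ, hcQ⟩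
    calc G c = G (cQ Q) := by rw [hcQ]
      _ ≤ ∑ Q' ∈ (reducedForms D).filter (fun Q => cQ Q = c), G (cQ Q') :=
          single_le_sum (f := fun Q' => G (cQ Q')) (fun Q' _ => hG0 _) hmem
  refine hstep.trans ?_
  rw [mul_sum]
  refine sum_le_sum fun Q hQ => ?_
  /- 4. the class `[𝔞_Q]⁻¹`: `G (cQ Q) ≤ B(Q)/2` -/
  obtain ⟨hdiscQ, hA, -, -⟩ := (mem_reducedForms_iff hD0).1 hQ
  rw [discr_apply] at hdiscQ
  have h𝔟0 : 𝔟 Q ∈ (Ideal (𝓞 K))⁰ := span_pair_mem_nonZeroDivisors b hb hA.ne' _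
  have hcQ : cQ Q = (ClassGroup.mk0 ⟨𝔟 Q, h𝔟0⟩)⁻¹ := by simp only [cQ, dif_pos hA]
  set A : ℤ := Q.1 with hAdef
  set Bq : ℤ := Q.2.1 with hBdef
  set C : ℤ := Q.2.2 with hCdef
  set k : ℤ := (Bq + t) / 2 with hk
  have hdisc' : Bq ^ 2 - 4 * A * C = t ^ 2 + 4 * m := by rw [← hDK]; exact hdiscQ
  have h2k : 2 * k = Bq + t := two_mul_ediv_two_of_disc_eq hdisc'
  have hn : A * C = k ^ 2 - t * k - m := norm_eq_of_disc_eq hdisc' h2k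
  have h𝔟Q : 𝔟 Q = Ideal.span {(A : 𝓞 K), b 1 - (k : 𝓞 K)} := rfl
  have h𝔟ne : 𝔟 Q ≠ 0 := nonZeroDivisors.ne_zero h𝔟0
  -- the form
  set ev : ℤ × ℤ → ℤ := fun v => A * v.1 ^ 2 + Bq * v.1 * v.2 + C * v.2 ^ 2 with hev
  have hev_nonneg : ∀ v : ℤ × ℤ, 0 ≤ ev v := fun v => by
    have e : 4 * A * ev v = (2 * A * v.1 + Bq * v.2) ^ 2 + (4 * A * C - Bq ^ 2) * v.2 ^ 2 := by
      rw [hev]; ring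
    have hq : 0 < 4 * A * C - Bq ^ 2 := by linarith
    nlinarith [sq_nonneg (2 * A * v.1 + Bq * v.2), sq_nonneg v.2]
  -- norms: `N𝔟 ≤ A`, `1 ≤ N𝔟`
  have hN𝔟le : (Ideal.absNorm (𝔟 Q) : ℤ) ≤ A := by
    rw [h𝔟Q, absNorm_span_pair_eq b hb hω hn, Int.natCast_natAbs, abs_of_pos hA]
  have hN𝔟pos : 0 < Ideal.absNorm (𝔟 Q) :=
    Nat.pos_of_ne_zero (mt Ideal.absNorm_eq_zero_iff.1 (by simpa using h𝔟ne))
  -- the fibre and its generators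
  set F : Finset (Ideal (𝓞 K)) := 𝓘.filter (fun I => cls I = cQ Q) with hF
  have hFmem : ∀ I ∈ F, I ≠ ⊥ ∧ Ideal.absNorm I ≤ N ∧
      ∃ x : 𝓞 K, x ≠ 0 ∧ I * 𝔟 Q = Ideal.span {x} := by
    intro I hI
    obtain ⟨hI𝓘, hcls⟩ := mem_filter.1 hI
    obtain ⟨hI0, hIN⟩ := hmem𝓘.1 hI𝓘
    refine ⟨hI0, hIN, ?_⟩
    simp only [cls, dif_neg hI0, hcQ] at hcls
    obtain ⟨x, hx, hIx⟩ := ClassGroup.mk0_eq_mk0_inv_iff.1 hcls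
    exact ⟨x, hx, hIx⟩
  choose! gen hgen0 hgenI using fun I hI => (hFmem I hI).2.2
  -- lattice coordinates of the generators
  have hco : ∀ I ∈ F, ∃ uv : ℤ × ℤ, gen I = (uv.1 : 𝓞 K) * A + (uv.2 : 𝓞 K) * (b 1 - k) := by
    intro I hI
    have hmem : gen I ∈ 𝔟 Q := by
      have : gen I ∈ I * 𝔟 Q := by rw [hgenI I hI]; exact Ideal.mem_span_singleton_self _
      exact Ideal.mul_le_left this
    rw [h𝔟Q] at hmem
    obtain ⟨u, v, huv⟩ := (mem_span_pair_iff_of_basis b hb hω hn (gen I)).1 hmem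
    exact ⟨(u, v), huv⟩
  choose! co hco using hco
  -- the key arithmetic: `N I · N𝔟 = A · Q(u, −v)`
  have hnormI : ∀ I ∈ F,
      (Ideal.absNorm I : ℤ) * Ideal.absNorm (𝔟 Q) = A * ev ((co I).1, -(co I).2) := by
    intro I hI
    have h1 : Ideal.absNorm (I * 𝔟 Q) = (Algebra.norm ℤ (gen I)).natAbs := by
      rw [hgenI I hI, Ideal.absNorm_span_singleton]
    rw [map_mul] at h1
    have h2 : Algebra.norm ℤ (gen I) = A * ev ((co I).1, -(co I).2) := by
      rw [hco I hI, norm_lattice_elt b hb hω hn, hev]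
      simp only
      have hB : t - 2 * k = -Bq := by linarith
      rw [hB]; ring
    have h3 : ((Ideal.absNorm I * Ideal.absNorm (𝔟 Q) : ℕ) : ℤ) =
        |A * ev ((co I).1, -(co I).2)| := by
      rw [h1, h2, Int.natCast_natAbs]
    rw [abs_of_nonneg (mul_nonneg hA.le (hev_nonneg _))] at h3
    exact_mod_cast h3
  have hevI : ∀ I ∈ F,
      1 ≤ ev ((co I).1, -(co I).2) ∧ ev ((co I).1, -(co I).2) ≤ Ideal.absNorm I := by
    intro I hI
    obtain ⟨hI0, hIN, -⟩ := hFmem I hI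
    have hNI : 0 < Ideal.absNorm I := Nat.pos_of_ne_zero (mt Ideal.absNorm_eq_zero_iff.1 hI0)
    have h := hnormI I hI
    have hNI' : (1 : ℤ) ≤ Ideal.absNorm I := by exact_mod_cast hNI
    have hN𝔟' : (1 : ℤ) ≤ Ideal.absNorm (𝔟 Q) := by exact_mod_cast hN𝔟pos
    constructor
    · by_contra hlt
      push Not at hlt
      have : A * ev ((co I).1, -(co I).2) ≤ 0 := by
        nlinarith [hev_nonneg ((co I).1, -(co I).2)]
      nlinarith
    · nlinarith
  -- the injection `(I, ±) ↦ ±(u, −v)`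
  let pt : Ideal (𝓞 K) × Bool → ℤ × ℤ := fun Is =>
    if Is.2 then ((co Is.1).1, -(co Is.1).2) else (-(co Is.1).1, (co Is.1).2)
  have hpt_ev : ∀ Is ∈ F ×ˢ (univ : Finset Bool),
      ev (pt Is) = ev ((co Is.1).1, -(co Is.1).2) := by
    rintro ⟨I, s⟩ -
    cases s
    · simp only [pt, Bool.false_eq_true, if_false, hev]
      ring
    · simp only [pt, if_true]
  have hinj : Set.InjOn pt ↑(F ×ˢ (univ : Finset Bool)) := by
    rintro ⟨I, s⟩ hI ⟨J, s'⟩ hJ h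
    rw [mem_coe, mem_product] at hI hJ
    have hIF : I ∈ F := hI.1
    have hJF : J ∈ F := hJ.1
    have hcases : co I = co J ∨ (co I).1 = -(co J).1 ∧ (co I).2 = -(co J).2 := by
      cases s <;> cases s' <;>
        simp only [pt, if_true, Bool.false_eq_true, if_false, Prod.mk.injEq] at h
      · exact Or.inl (Prod.ext (by linarith [h.1]) (by linarith [h.2]))
      · exact Or.inr ⟨by linarith [h.1], by linarith [h.2]⟩
      · exact Or.inr ⟨by linarith [h.1], by linarith [h.2]⟩
      · exact Or.inl (Prod.ext (by linarith [h.1]) (by linarith [h.2]))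
    have hcancel : ∀ {I J : Ideal (𝓞 K)}, I ∈ F → J ∈ F →
        Ideal.span {gen I} = Ideal.span {gen J} → I = J := by
      intro I J hI hJ hIJ
      have : I * 𝔟 Q = J * 𝔟 Q := by rw [hgenI I hI, hgenI J hJ, hIJ]
      exact mul_right_cancel₀ h𝔟ne this
    rcases hcases with hc | ⟨hc1, hc2⟩
    · have hIJ : I = J := hcancel hIF hJF (by rw [hco I hIF, hco J hJF, hc])
      subst hIJ
      cases s <;> cases s' <;>
        simp only [pt, if_true, Bool.false_eq_true, if_false, Prod.mk.injEq] at h ⊢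
      · have h1 := (hevI I hIF).1
        exfalso
        have hz : (co I).1 = 0 ∧ (co I).2 = 0 := ⟨by linarith [h.1], by linarith [h.2]⟩
        have : ev ((co I).1, -(co I).2) = 0 := by rw [hev]; simp [hz.1, hz.2]
        omega
      · have h1 := (hevI I hIF).1
        exfalso
        have hz : (co I).1 = 0 ∧ (co I).2 = 0 := ⟨by linarith [h.1], by linarith [h.2]⟩
        have : ev ((co I).1, -(co I).2) = 0 := by rw [hev]; simp [hz.1, hz.2]
        omega
    · have hgIJ : gen I = -gen J := by
        have hc1' : (((co I).1 : ℤ) : 𝓞 K) = -(((co J).1 : ℤ) : 𝓞 K) := by exact_mod_cast hc1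
        have hc2' : (((co I).2 : ℤ) : 𝓞 K) = -(((co J).2 : ℤ) : 𝓞 K) := by exact_mod_cast hc2
        rw [hco I hIF, hco J hJF, hc1', hc2']; ring
      have hIJ : I = J := hcancel hIF hJF (by rw [hgIJ, Ideal.span_singleton_neg])
      subst hIJ
      have hz : gen I = 0 := add_self_eq_zero.1 (eq_neg_iff_add_eq_zero.1 hgIJ)
      exact absurd hz (hgen0 I hIF)
  -- the image is an admissible set of lattice points
  set T : Finset (ℤ × ℤ) := (F ×ˢ (univ : Finset Bool)).image pt with hT
  have hTadm : ∀ v ∈ T, v ≠ 0 ∧ A * v.1 ^ 2 + Bq * v.1 * v.2 + C * v.2 ^ 2 ≤ N := by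
    intro v hv
    obtain ⟨Is, hIs, rfl⟩ := mem_image.1 hv
    have hI : Is.1 ∈ F := (mem_product.1 hIs).1
    obtain ⟨h1, h2⟩ := hevI Is.1 hI
    obtain ⟨-, hIN, -⟩ := hFmem Is.1 hI
    have hev' : ev (pt Is) = ev ((co Is.1).1, -(co Is.1).2) := hpt_ev Is hIs
    refine ⟨fun h0 => ?_, ?_⟩
    · have : ev (pt Is) = 0 := by rw [h0, hev]; simp
      omega
    · change ev (pt Is) ≤ N
      rw [hev']
      exact h2.trans (by exact_mod_cast hIN)
  have hBQ := hB Q hQ T hTadm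
  -- compare the counts: `2 · #F = #(F × Bool) = #T ≤ B(Q)`
  have hcardT : T.card = 2 * F.card := by
    rw [hT, card_image_of_injOn hinj, card_product, card_univ, Fintype.card_bool, mul_comm]
  have hG : G (cQ Q) = (F.card : ℝ) := rfl
  rw [hG]
  have h2F : (2 : ℝ) * F.card ≤ B Q := by
    have : ((T.card : ℕ) : ℝ) = 2 * (F.card : ℝ) := by rw [hcardT]; push_cast; ring
    linarith
  linarith

/-! ### Lattice points of a reduced form in a disc -/

/-- Integers of bounded absolute value: a finite set of integers `x` with `|x| ≤ X` has at most
`2X + 1` elements (`S ⊆ [−⌊X⌋, ⌊X⌋]`). [folklore] -/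
theorem card_le_of_forall_abs_le (S : Finset ℤ) {X : ℝ} (hX : 0 ≤ X)
    (h : ∀ x ∈ S, |(x : ℝ)| ≤ X) : (S.card : ℝ) ≤ 2 * X + 1 := by
  have hsub : S ⊆ Finset.Icc (-⌊X⌋) ⌊X⌋ := by
    intro x hx
    obtain ⟨h1, h2⟩ := abs_le.mp (h x hx)
    rw [Finset.mem_Icc]
    constructor
    · have : -x ≤ ⌊X⌋ := Int.le_floor.mpr (by push_cast; linarith)
      linarith
    · exact Int.le_floor.mpr h2
  have hfl : (0 : ℤ) ≤ ⌊X⌋ := Int.floor_nonneg.mpr hX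
  have hcard : ((Finset.Icc (-⌊X⌋) ⌊X⌋).card : ℝ) = 2 * (⌊X⌋ : ℝ) + 1 := by
    rw [Int.card_Icc, show ⌊X⌋ + 1 - -⌊X⌋ = 2 * ⌊X⌋ + 1 by ring]
    have : ((2 * ⌊X⌋ + 1).toNat : ℤ) = 2 * ⌊X⌋ + 1 := Int.toNat_of_nonneg (by linarith)
    exact_mod_cast this
  have hle : (S.card : ℝ) ≤ ((Finset.Icc (-⌊X⌋) ⌊X⌋).card : ℝ) := by
    exact_mod_cast Finset.card_le_card hsub
  have hflX : (⌊X⌋ : ℝ) ≤ X := Int.floor_le X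
  linarith

/-- The bookkeeping inequality of the lattice-point count: with `u = √(aN)/a`, `w = √(aN)/√|D|`,
`M = √N`, `P = N/√|D|` one has `u, w ≤ M`, `uw = P`, `w² ≤ P`, and then (no sign conditions needed)
`(2u + 2w + 1)(4w + 1) ≤ 16P + 8M + 1`. [folklore] -/
theorem count_bookkeeping {u w M P : ℝ} (huM : u ≤ M) (hwM : w ≤ M)
    (huw : u * w = P) (hw2 : w ^ 2 ≤ P) :
    (2 * u + 2 * w + 1) * (4 * w + 1) ≤ 16 * P + 8 * M + 1 := by
  nlinarith
set_option maxHeartbeats 400000 in -- buildfix (bf3-g26): 160k/180k FAIL, 200k PASS at accept time; line-neutral budget line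
/-- **Lattice points of a reduced form in a disc.** For a reduced primitive positive definite form
`Q = (a, b, c)` of discriminant `D < 0` and a finite set `T` of lattice points `v = (x, y)` with
`Q(v) ≤ N`: `#T ≤ 16 N/√|D| + 8 √N + 1`. Proof: `4a Q(x, y) = (2ax + by)² + |D| y²`, so
`|y| ≤ 2√(aN)/√|D|` and `|x| ≤ √(aN)/a + |y|/2`; count the box, using `1 ≤ a` and `a² ≤ |D|/3`
(`3a² ≤ |D|` for a reduced form, Cox (2.12)). Davenport, Ch. 6 (the count behind `∑_{n ≤ N} r(n)`).
[cite: DavenportMNT1980, Ch. 6] -/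
theorem card_latticePoints_le_of_mem_reducedForms {D : ℤ} (hD : D < 0) {Q : ℤ × ℤ × ℤ}
    (hQ : Q ∈ reducedForms D) (N : ℕ) (T : Finset (ℤ × ℤ))
    (hT : ∀ v ∈ T, v ≠ 0 ∧ Q.1 * v.1 ^ 2 + Q.2.1 * v.1 * v.2 + Q.2.2 * v.2 ^ 2 ≤ N) :
    (T.card : ℝ) ≤ 16 * N / Real.sqrt (-D : ℝ) + 8 * Real.sqrt N + 1 := by
  obtain ⟨a, b, c⟩ := Q
  obtain ⟨hdisc, ha, -, hred⟩ := (mem_reducedForms_iff hD).1 hQ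
  obtain ⟨-, hb1, hb2, hac⟩ := le_of_isReduced hdisc ha hred
  rw [discr_apply] at hdisc
  simp only at ha hT
  -- `3a² ≤ |D|`, hence `a² ≤ −D` and `a ≤ −D`
  have hbb : b ^ 2 ≤ a ^ 2 := by nlinarith
  have h3a : 3 * a ^ 2 ≤ -D := by nlinarith
  have ha2 : a ^ 2 ≤ -D := by nlinarith
  have ha1 : 1 ≤ a := ha
  have haD : a ≤ -D := by nlinarith
  -- real parameters
  have haR : (0 : ℝ) < a := by exact_mod_cast ha
  have ha1R : (1 : ℝ) ≤ a := by exact_mod_cast ha1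
  have hDR : (0 : ℝ) < -D := by exact_mod_cast (by linarith : (0 : ℤ) < -D)
  have ha2R : (a : ℝ) ^ 2 ≤ -D := by exact_mod_cast ha2
  have haDR : (a : ℝ) ≤ -D := by exact_mod_cast haD
  have hN0 : (0 : ℝ) ≤ N := Nat.cast_nonneg N
  set r : ℝ := Real.sqrt (-D : ℝ) with hr
  set s : ℝ := Real.sqrt ((a : ℝ) * N) with hs
  have hr0 : 0 < r := Real.sqrt_pos.mpr hDR
  have hs0 : 0 ≤ s := Real.sqrt_nonneg _
  have hrsq : r ^ 2 = -D := Real.sq_sqrt hDR.le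
  have hssq : s ^ 2 = a * N := Real.sq_sqrt (mul_nonneg haR.le hN0)
  -- the two coordinate bounds
  have hbound : ∀ v ∈ T, |((v.2 : ℤ) : ℝ)| ≤ 2 * s / r ∧ |((v.1 : ℤ) : ℝ)| ≤ s / a + s / r := by
    intro v hv
    obtain ⟨-, hvN⟩ := hT v hv
    set x : ℤ := v.1 with hx
    set y : ℤ := v.2 with hy
    -- `(2ax + by)² + (−D) y² ≤ 4 a N` in `ℤ`
    have hkey : (2 * a * x + b * y) ^ 2 + (-D) * y ^ 2 ≤ 4 * a * N := by
      have e : (2 * a * x + b * y) ^ 2 + (-D) * y ^ 2 = 4 * a * (a * x ^ 2 + b * x * y + c * y ^ 2) := by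
        rw [← hdisc]; ring
      rw [e]
      exact mul_le_mul_of_nonneg_left hvN (by linarith)
    have hsq1 : (0 : ℤ) ≤ (2 * a * x + b * y) ^ 2 := sq_nonneg _
    have hsq2 : (0 : ℤ) ≤ (-D) * y ^ 2 := mul_nonneg (by linarith) (sq_nonneg _)
    have hy2 : (-D) * y ^ 2 ≤ 4 * a * N := by linarith
    have hx2 : (2 * a * x + b * y) ^ 2 ≤ 4 * a * N := by linarith
    have hy2R : ((-D : ℤ) : ℝ) * (y : ℝ) ^ 2 ≤ 4 * (a : ℝ) * N := by exact_mod_cast hy2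
    have hx2R : (2 * (a : ℝ) * x + b * y) ^ 2 ≤ 4 * (a : ℝ) * N := by exact_mod_cast hx2
    push_cast at hy2R
    have h4aN : 4 * (a : ℝ) * N = (2 * s) ^ 2 := by rw [mul_pow, hssq]; ring
    -- `|y| ≤ 2s/r`
    have hyb : |(y : ℝ)| ≤ 2 * s / r := by
      rw [le_div_iff₀ hr0]
      have h1 : (|(y : ℝ)| * r) ^ 2 ≤ (2 * s) ^ 2 := by
        rw [mul_pow, sq_abs, hrsq, ← h4aN]; linarith
      have h2 : 0 ≤ 2 * s := by linarith
      nlinarith [abs_nonneg (y : ℝ), sq_nonneg (|(y : ℝ)| * r - 2 * s), sq_nonneg (|(y : ℝ)| * r + 2 * s)]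
    -- `|2ax + by| ≤ 2s`
    have hlin : |2 * (a : ℝ) * x + b * y| ≤ 2 * s := by
      have h1 : (2 * (a : ℝ) * x + b * y) ^ 2 ≤ (2 * s) ^ 2 := by rw [← h4aN]; exact hx2R
      exact abs_le.mpr (abs_le_of_sq_le_sq' h1 (by linarith))
    -- `|x| ≤ s/a + |y|/2 ≤ s/a + s/r`
    have hbR : |(b : ℝ)| ≤ a := by
      rw [abs_le]; constructor <;> [exact_mod_cast hb1; exact_mod_cast hb2]
    have hxb : |(x : ℝ)| ≤ s / a + s / r := by
      have h1 : 2 * (a : ℝ) * |(x : ℝ)| ≤ 2 * s + |(b : ℝ)| * |(y : ℝ)| := by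
        have := abs_sub (2 * (a : ℝ) * x + b * y) (b * y)
        rw [add_sub_cancel_right, abs_mul (2 * (a : ℝ)) x, abs_mul (b : ℝ) y,
          abs_of_pos (by linarith : (0 : ℝ) < 2 * a)] at this
        linarith
      have h2 : |(b : ℝ)| * |(y : ℝ)| ≤ a * (2 * s / r) :=
        mul_le_mul hbR hyb (abs_nonneg _) haR.le
      have h3 : 2 * (a : ℝ) * |(x : ℝ)| ≤ 2 * s + a * (2 * s / r) := by linarith
      have h4 : |(x : ℝ)| ≤ (2 * s + a * (2 * s / r)) / (2 * a) := by
        rw [le_div_iff₀ (by linarith)]; linarith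
      have h5 : (2 * s + a * (2 * s / r)) / (2 * a) = s / a + s / r := by
        field_simp
      linarith
    exact ⟨hyb, hxb⟩
  -- count the box
  have hX0 : 0 ≤ s / a + s / r := by positivity
  have hY0 : 0 ≤ 2 * s / r := by positivity
  have hcardX : ((T.image Prod.fst).card : ℝ) ≤ 2 * (s / a + s / r) + 1 := by
    refine card_le_of_forall_abs_le _ hX0 fun x hx => ?_
    obtain ⟨v, hv, rfl⟩ := Finset.mem_image.mp hx
    exact (hbound v hv).2
  have hcardY : ((T.image Prod.snd).card : ℝ) ≤ 2 * (2 * s / r) + 1 := by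
    refine card_le_of_forall_abs_le _ hY0 fun y hy => ?_
    obtain ⟨v, hv, rfl⟩ := Finset.mem_image.mp hy
    exact (hbound v hv).1
  have hTle : (T.card : ℝ) ≤ ((T.image Prod.fst).card : ℝ) * ((T.image Prod.snd).card : ℝ) := by
    have := Finset.card_le_card (Finset.subset_product (s := T))
    rw [Finset.card_product] at this
    exact_mod_cast this
  -- bookkeeping with `u = s/a`, `w = s/r`, `M = √N`, `P = N/r`
  have hsN : Real.sqrt N ^ 2 = N := Real.sq_sqrt hN0
  have hsN0 : 0 ≤ Real.sqrt N := Real.sqrt_nonneg _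
  have huM : s / a ≤ Real.sqrt N := by
    rw [div_le_iff₀ haR]
    have h1 : s ^ 2 ≤ (Real.sqrt N * a) ^ 2 := by
      rw [mul_pow, hsN, hssq]; nlinarith
    nlinarith [sq_nonneg (s - Real.sqrt N * a), sq_nonneg (s + Real.sqrt N * a),
      mul_nonneg hsN0 haR.le]
  have hwM : s / r ≤ Real.sqrt N := by
    rw [div_le_iff₀ hr0]
    have h1 : s ^ 2 ≤ (Real.sqrt N * r) ^ 2 := by
      rw [mul_pow, hsN, hssq, hrsq]; nlinarith
    nlinarith [sq_nonneg (s - Real.sqrt N * r), sq_nonneg (s + Real.sqrt N * r),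
      mul_nonneg hsN0 hr0.le]
  have huw : s / a * (s / r) = N / r := by
    rw [div_mul_div_comm, ← sq, hssq]
    field_simp
  have hw2 : (s / r) ^ 2 ≤ N / r := by
    rw [div_pow, hssq, hrsq, div_le_div_iff₀ hDR hr0]
    -- `a N r ≤ N (−D)`, i.e. `a r ≤ r²`
    have har : (a : ℝ) * r ≤ r ^ 2 := by
      have : (a : ℝ) ≤ r := by
        rw [hr]
        calc (a : ℝ) = Real.sqrt ((a : ℝ) ^ 2) := (Real.sqrt_sq haR.le).symm
          _ ≤ Real.sqrt (-D : ℝ) := Real.sqrt_le_sqrt ha2R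
      nlinarith
    rw [hrsq] at har
    nlinarith
  have hbook := count_bookkeeping huM hwM huw hw2
  calc (T.card : ℝ) ≤ ((T.image Prod.fst).card : ℝ) * ((T.image Prod.snd).card : ℝ) := hTle
    _ ≤ (2 * (s / a + s / r) + 1) * (2 * (2 * s / r) + 1) :=
        mul_le_mul hcardX hcardY (Nat.cast_nonneg _) (by linarith)
    _ = (2 * (s / a) + 2 * (s / r) + 1) * (4 * (s / r) + 1) := by ring
    _ ≤ 16 * (N / r) + 8 * Real.sqrt N + 1 := hbook
    _ = 16 * N / r + 8 * Real.sqrt N + 1 := by ring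

/-! ### The count against the class number -/

/-- **`#{𝔞 ≠ 0 : N𝔞 ≤ N} ≤ ½ h_K (16 N/√|d_K| + 8 √N + 1)`** for an imaginary quadratic field `K`:
`card_nonzero_ideals_le` with the uniform lattice-point bound
`card_latticePoints_le_of_mem_reducedForms`, and `#reducedForms d_K = h_K`
(`Quadratic.card_reducedForms_eq_classNumber`, Cox Thm. 7.7(ii)). Davenport, Ch. 6.
[cite: DavenportMNT1980, Ch. 6] -/
theorem card_nonzero_ideals_le_classNumber_mul (hK : IsImaginaryQuadratic K) (N : ℕ) :
    (Set.ncard {I : Ideal (𝓞 K) | I ≠ ⊥ ∧ Ideal.absNorm I ≤ N} : ℝ) ≤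
      (1 / 2) * NumberField.classNumber K *
        (16 * N / Real.sqrt (-(NumberField.discr K) : ℝ) + 8 * Real.sqrt N + 1) := by
  have hD0 : NumberField.discr K < 0 := hK.discr_neg
  have h := card_nonzero_ideals_le hK N
    (fun _ => 16 * N / Real.sqrt (-(NumberField.discr K) : ℝ) + 8 * Real.sqrt N + 1)
    (fun Q hQ T hT => card_latticePoints_le_of_mem_reducedForms hD0 hQ N T hT)
  rw [sum_const, nsmul_eq_mul] at h
  have hcard : ((reducedForms (NumberField.discr K)).card : ℝ) = NumberField.classNumber K := by
    have := card_reducedForms_eq_classNumber hK.1 hD0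
    rw [Literature.NumberTheory.QuadraticFields.BinaryQuadraticForm.classNumber] at this
    exact_mod_cast this
  rw [hcard] at h
  linarith

end Literature.Computability.Cryptography.Hallgren2005

end
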